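import Mathlib
import HarnessLib

/-!
# `WakeRatchet.TailRatchet` (stmt-NavierStokesRegularity-21808), door D4′ — the SELF-DRAIN peak-delay lemma

Def-free support lemmas (`--supports stmt-NavierStokesRegularity-21808`) for the one estimate left on door D4′ of the
refutation of `TailRatchet`: the post-firing bound (D) `WakeRatchetDyadicPostFiring.DyadicCauchyPostFiringBound`, which
the tree reduces (`WakeRatchetDyadicPostFiring.cauchyPostFiringBound_of_unimodal`, p840254) to UNIMODALITY (U) and the
PEAK DELAY (R′) of the one-shell non-negative dyadic cascade `Ẋₙ = Λⁿ⁻¹Xₙ₋₁² − ΛⁿXₙXₙ₊₁` (`uₙ := ΛⁿXₙ` solves the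
shift-invariant lattice `u̇ₙ = Λuₙ₋₁² − Λ⁻¹uₙuₙ₊₁`).

THE MECHANISM RECORDED HERE (self-drain): a shell that keeps the renormalised level `uₖ(τ)(T−τ) ≥ c` on a time window
`[t, p]` FEEDS ITS OWN DRAIN — the shell above obeys `u̇ₖ₊₁ ≥ Λuₖ²/2` as long as the look-ahead product is small
(`ΛXₖ₊₁Xₖ₊₂ ≤ Xₖ²/2`), hence `uₖ₊₁(τ) ≥ (Λc²/2)((T−τ)⁻¹ − (T−t)⁻¹)` (`drain_buildup`), and then the drain
`Λ⁻¹uₖuₖ₊₁ ≥ (c³/2)(T−τ)⁻¹((T−τ)⁻¹ − (T−t)⁻¹)` integrates to `(c³/2)(x − 1 − log x)/(T−t)`, `x = (T−t)/(T−p)`, while a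
feed bounded by `F` contributes at most `F(p−t)`.  So if the shell has not come down by time `p` (`uₖ(t) ≤ uₖ(p)`):
`(c³/2)(x − 1 − log x) ≤ F(p−t)(T−t)` (`level_cost_le_feed`) and `T − t ≤ (2 + 4F(T−t)²/c³)(T − p)`
(`remaining_time_le`).  For the cascade (`dyadic_peak_delay_bottom_shell`): at the BOTTOM of the rising chain (shell
`k−1` already non-increasing on `[t,p]`, type-I `Λᵏ⁻¹Xₖ₋₁(t)(T−t) ≤ K` at the initial time), a shell holding level `c`
with small look-ahead is past its last rise within `x ≤ 2 + 4ΛK²/c³` of the self-similar clock — the quantitative form of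
«drain overtakes feed once the shell below decays», to be iterated up the rising chain for (R′).

NUMERICAL STATUS of the hypotheses along the one-shell blow-up (this session, pure-python RK4, shells 4…44, evidence
CENSUS-21808-leafhand4-g20.md): at `Λ = 1.5 / 1.3 / 1.15` every shell is unimodal with ordered peaks, the renormalised
level is non-decreasing from first firing (`c₀ = 1/(2(Λ+Λ⁻¹))`) to the peak, the look-ahead ratio
`max ΛXₖ₊₁Xₖ₊₂/Xₖ²` on `[firing, peak]` is `0.30 / 0.16 / 0.09 < 1/2`, and exactly 3 shells are rising at level `≥ c₀`
when a shell fires (chain length 3); the peak delay is `log((T−s)/(T−p)) = 0.82 / 0.49 / 0.25`.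

HONEST FRAMING: MODEL lattice ODEs (the scalar dyadic member of Tao 2016 §1.2/§4); elementary real analysis; (U), (R′),
(D) are NOT proved here, stmt-21808 is neither proved nor refuted, no stub of skeleton d00b85951d7c is closed; rung 0.
-/

noncomputable section

set_option linter.dupNamespace false

namespace Summit.NavierStokesRegularity.NavierStokesRegularity.Theorems

namespace WakeRatchetPeakDelaySelfDrain

open Set

/-- `x ≤ 2(1 + β)` as soon as `x − 1 − log x ≤ β` (`x > 0`; via `log x ≤ x/2`, from `log y ≤ y − 1` at
`y = x/2` and `log 2 ≤ 1`). [folklore] -/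
theorem le_of_sub_log_le {x β : ℝ} (hx : 0 < x) (h : x - 1 - Real.log x ≤ β) : x ≤ 2 * (1 + β) := by
  have h1 : Real.log (x / 2) ≤ x / 2 - 1 := Real.log_le_sub_one_of_pos (by positivity)
  have h2 : Real.log 2 ≤ 2 - 1 := Real.log_le_sub_one_of_pos (by norm_num)
  have h3 : Real.log (x / 2) = Real.log x - Real.log 2 := Real.log_div hx.ne' (by norm_num)
  linarith

/-- **Drain build-up.**  If `w' ≥ (Λ/2) v²` and `v(τ) ≥ c/(T−τ)` on `[t,p]` (`p < T`), `w(t) ≥ 0`, then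
`w(τ) ≥ (Λc²/2)((T−τ)⁻¹ − (T−t)⁻¹)` on `[t,p]`.
[cite: Tao2016AveragedNS, §1.2 (dyadic model); elementary real analysis (door D4′ of stmt-21808)] -/
theorem drain_buildup {v w dw : ℝ → ℝ} {Λ c T t p : ℝ} (hΛ : 0 ≤ Λ) (hc : 0 ≤ c) (hpT : p < T)
    (hw : ∀ τ ∈ Icc t p, HasDerivAt w (dw τ) τ)
    (hdw : ∀ τ ∈ Icc t p, Λ / 2 * v τ ^ 2 ≤ dw τ)
    (hlev : ∀ τ ∈ Icc t p, c / (T - τ) ≤ v τ) (hw0 : 0 ≤ w t) :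
    ∀ τ ∈ Icc t p, Λ * c ^ 2 / 2 * ((T - τ)⁻¹ - (T - t)⁻¹) ≤ w τ := by
  -- ψ τ := w τ - Λc²/2 ((T-τ)⁻¹ - (T-t)⁻¹) is monotone on [t,p]
  set ψ : ℝ → ℝ := fun τ => w τ - Λ * c ^ 2 / 2 * ((T - τ)⁻¹ - (T - t)⁻¹) with hψ
  have hsub : ∀ τ : ℝ, HasDerivAt (fun y => T - y) (-1) τ := fun τ => by
    simpa using (hasDerivAt_id τ).const_sub T
  have hinv : ∀ τ ∈ Icc t p, HasDerivAt (fun y => (T - y)⁻¹) ((T - τ)⁻¹ ^ 2) τ := by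
    intro τ hτ
    have hne : T - τ ≠ 0 := by linarith [hτ.2]
    have h := ((hsub τ).inv hne).congr_deriv (by rw [neg_neg, one_div, ← inv_pow])
    exact h
  have hψ' : ∀ τ ∈ Icc t p, HasDerivAt ψ (dw τ - Λ * c ^ 2 / 2 * (T - τ)⁻¹ ^ 2) τ := by
    intro τ hτ
    have h := (hw τ hτ).sub (((hinv τ hτ).sub_const ((T - t)⁻¹)).const_mul (Λ * c ^ 2 / 2))
    exact h.congr_of_eventuallyEq (Filter.Eventually.of_forall fun y => by
      simp only [hψ, Pi.sub_apply])
  have hcont : ContinuousOn ψ (Icc t p) := fun τ hτ => (hψ' τ hτ).continuousAt.continuousWithinAt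
  have hmono : MonotoneOn ψ (Icc t p) := by
    refine monotoneOn_of_hasDerivWithinAt_nonneg (f' := fun τ => dw τ - Λ * c ^ 2 / 2 * (T - τ)⁻¹ ^ 2)
      (convex_Icc t p) hcont ?_ ?_
    · intro τ hτ
      rw [interior_Icc] at hτ
      exact (hψ' τ (Ioo_subset_Icc_self hτ)).hasDerivWithinAt
    · intro τ hτ
      rw [interior_Icc] at hτ
      have hτ' : τ ∈ Icc t p := Ioo_subset_Icc_self hτ
      have hTτ : 0 < T - τ := by linarith [hτ.2]
      have hv : c / (T - τ) ≤ v τ := hlev τ hτ'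
      have hv0 : 0 ≤ c / (T - τ) := div_nonneg hc hTτ.le
      have hsq : (c / (T - τ)) ^ 2 ≤ v τ ^ 2 := pow_le_pow_left₀ hv0 hv 2
      have heq : (c / (T - τ)) ^ 2 = c ^ 2 * (T - τ)⁻¹ ^ 2 := by rw [div_eq_mul_inv, mul_pow]
      have h1 := hdw τ hτ'
      nlinarith
  intro τ hτ
  have ht : t ∈ Icc t p := left_mem_Icc.2 (hτ.1.trans hτ.2)
  have h : ψ t ≤ ψ τ := hmono ht hτ hτ.1
  have hψt : ψ t = w t := by simp [hψ]
  rw [hψt] at h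
  simp only [hψ] at h
  linarith

/-- **The level costs feed (self-drain inequality).**  On `[t,p]` (`t ≤ p < T`) let `v' ≤ F − Λ⁻¹ v w`,
`w' ≥ (Λ/2) v²`, `v(τ) ≥ c/(T−τ)` (`c ≥ 0`, `Λ > 0`), `w(t) ≥ 0`, and suppose the shell has not come down:
`v(t) ≤ v(p)`.  Then with `x = (T−t)/(T−p)`:  `(c³/2)(x − 1 − log x) ≤ F (p − t)(T − t)`.
[cite: Tao2016AveragedNS, §1.2 (dyadic model); elementary real analysis (door D4′ of stmt-21808)] -/
theorem level_cost_le_feed {v w dv dw : ℝ → ℝ} {Λ F c T t p : ℝ} (hΛ : 0 < Λ) (hc : 0 ≤ c) (htp : t ≤ p)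
    (hpT : p < T)
    (hv : ∀ τ ∈ Icc t p, HasDerivAt v (dv τ) τ) (hw : ∀ τ ∈ Icc t p, HasDerivAt w (dw τ) τ)
    (hdv : ∀ τ ∈ Icc t p, dv τ ≤ F - Λ⁻¹ * v τ * w τ)
    (hdw : ∀ τ ∈ Icc t p, Λ / 2 * v τ ^ 2 ≤ dw τ)
    (hlev : ∀ τ ∈ Icc t p, c / (T - τ) ≤ v τ) (hw0 : 0 ≤ w t) (hend : v t ≤ v p) :
    c ^ 3 / 2 * ((T - t) / (T - p) - 1 - Real.log ((T - t) / (T - p))) ≤ F * (p - t) * (T - t) := by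
  have hTt : 0 < T - t := by linarith
  have hTp : 0 < T - p := by linarith
  have hdrain := drain_buildup hΛ.le hc hpT hw hdw hlev hw0
  -- θ τ := v τ - F τ + (c³/2) ((T-τ)⁻¹ + (T-t)⁻¹ log (T-τ)) is antitone on [t,p]
  set θ : ℝ → ℝ := fun τ => v τ - F * τ + c ^ 3 / 2 * ((T - τ)⁻¹ + (T - t)⁻¹ * Real.log (T - τ))
    with hθ
  have hsub : ∀ τ : ℝ, HasDerivAt (fun y => T - y) (-1) τ := fun τ => by
    simpa using (hasDerivAt_id τ).const_sub T
  have hinv : ∀ τ ∈ Icc t p, HasDerivAt (fun y => (T - y)⁻¹) ((T - τ)⁻¹ ^ 2) τ := by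
    intro τ hτ
    have hne : T - τ ≠ 0 := by linarith [hτ.2]
    have h := ((hsub τ).inv hne).congr_deriv (by rw [neg_neg, one_div, ← inv_pow])
    exact h
  have hlog : ∀ τ ∈ Icc t p, HasDerivAt (fun y => Real.log (T - y)) (-(T - τ)⁻¹) τ := by
    intro τ hτ
    have hne : T - τ ≠ 0 := by linarith [hτ.2]
    have h := (hsub τ).log hne
    convert h using 1
    rw [neg_div, one_div]
  have hθ' : ∀ τ ∈ Icc t p, HasDerivAt θ
      (dv τ - F + c ^ 3 / 2 * ((T - τ)⁻¹ ^ 2 + (T - t)⁻¹ * (-(T - τ)⁻¹))) τ := by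
    intro τ hτ
    have h1 : HasDerivAt (fun y => F * y) F τ := by simpa using (hasDerivAt_id τ).const_mul F
    have h := ((hv τ hτ).sub h1).add
      (((hinv τ hτ).add ((hlog τ hτ).const_mul ((T - t)⁻¹))).const_mul (c ^ 3 / 2))
    exact h.congr_of_eventuallyEq (Filter.Eventually.of_forall fun y => by
      simp only [hθ, Pi.add_apply, Pi.sub_apply])
  have hcont : ContinuousOn θ (Icc t p) := fun τ hτ => (hθ' τ hτ).continuousAt.continuousWithinAt
  have hanti : AntitoneOn θ (Icc t p) := by
    refine antitoneOn_of_hasDerivWithinAt_nonpos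
      (f' := fun τ => dv τ - F + c ^ 3 / 2 * ((T - τ)⁻¹ ^ 2 + (T - t)⁻¹ * -(T - τ)⁻¹))
      (convex_Icc t p) hcont ?_ ?_
    · intro τ hτ
      rw [interior_Icc] at hτ
      exact (hθ' τ (Ioo_subset_Icc_self hτ)).hasDerivWithinAt
    · intro τ hτ
      rw [interior_Icc] at hτ
      have hτ' : τ ∈ Icc t p := Ioo_subset_Icc_self hτ
      have hTτ : 0 < T - τ := by linarith [hτ.2]
      -- lower bounds: v ≥ c/(T-τ) ≥ 0, w ≥ (Λc²/2)((T-τ)⁻¹ - (T-t)⁻¹) ≥ 0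
      have hv1 : c / (T - τ) ≤ v τ := hlev τ hτ'
      have ha0 : 0 ≤ c / (T - τ) := div_nonneg hc hTτ.le
      have hw1 : Λ * c ^ 2 / 2 * ((T - τ)⁻¹ - (T - t)⁻¹) ≤ w τ := hdrain τ hτ'
      have hdiff : 0 ≤ (T - τ)⁻¹ - (T - t)⁻¹ := by
        rw [sub_nonneg]
        exact inv_anti₀ hTτ (by linarith [hτ.1])
      have hb0 : 0 ≤ Λ * c ^ 2 / 2 * ((T - τ)⁻¹ - (T - t)⁻¹) := by positivity
      have hprod : c / (T - τ) * (Λ * c ^ 2 / 2 * ((T - τ)⁻¹ - (T - t)⁻¹)) ≤ v τ * w τ :=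
        mul_le_mul hv1 hw1 hb0 (ha0.trans hv1)
      have h1 := hdv τ hτ'
      have hΛinv : 0 < Λ⁻¹ := inv_pos.2 hΛ
      have hkey : Λ⁻¹ * (c / (T - τ) * (Λ * c ^ 2 / 2 * ((T - τ)⁻¹ - (T - t)⁻¹)))
          = c ^ 3 / 2 * ((T - τ)⁻¹ ^ 2 + (T - t)⁻¹ * (-(T - τ)⁻¹)) := by
        field_simp
        ring
      have h2 : Λ⁻¹ * (c / (T - τ) * (Λ * c ^ 2 / 2 * ((T - τ)⁻¹ - (T - t)⁻¹))) ≤ Λ⁻¹ * (v τ * w τ) :=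
        mul_le_mul_of_nonneg_left hprod hΛinv.le
      rw [hkey] at h2
      have h3 : dv τ ≤ F - Λ⁻¹ * (v τ * w τ) := by rw [mul_assoc] at h1; exact h1
      linarith
  -- compare the endpoints
  have ht : t ∈ Icc t p := left_mem_Icc.2 htp
  have hp : p ∈ Icc t p := right_mem_Icc.2 htp
  have hθtp : θ p ≤ θ t := hanti ht hp htp
  simp only [hθ] at hθtp
  -- rewrite log ((T-t)/(T-p)) and (T-t)/(T-p)
  have hlogdiv : Real.log ((T - t) / (T - p)) = Real.log (T - t) - Real.log (T - p) :=
    Real.log_div hTt.ne' hTp.ne'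
  rw [hlogdiv]
  have hx : (T - t) / (T - p) = (T - t) * (T - p)⁻¹ := div_eq_mul_inv _ _
  rw [hx]
  have hTt' : (T - t) * (T - t)⁻¹ = 1 := mul_inv_cancel₀ hTt.ne'
  -- multiply the endpoint inequality by (T - t) > 0
  have key : c ^ 3 / 2 * ((T - p)⁻¹ - (T - t)⁻¹ + (T - t)⁻¹ * (Real.log (T - p) - Real.log (T - t)))
      ≤ F * (p - t) := by nlinarith
  have key2 := mul_le_mul_of_nonneg_right key hTt.le
  have expand : c ^ 3 / 2 * ((T - p)⁻¹ - (T - t)⁻¹ + (T - t)⁻¹ * (Real.log (T - p) - Real.log (T - t)))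
      * (T - t) = c ^ 3 / 2 * ((T - t) * (T - p)⁻¹ - 1 - (Real.log (T - t) - Real.log (T - p))) := by
    field_simp
    ring
  rw [expand] at key2
  linarith

/-- **Remaining-time bound.**  Under the hypotheses of `level_cost_le_feed` with `F ≥ 0` and `c > 0`:
`T − t ≤ (2 + 4F(T−t)²/c³)(T − p)` — a shell that keeps the renormalised level `c` and whose feed is bounded by `F`
cannot still be rising later than that.
[cite: Tao2016AveragedNS, §1.2 (dyadic model); elementary real analysis (door D4′ of stmt-21808)] -/
theorem remaining_time_le {v w dv dw : ℝ → ℝ} {Λ F c T t p : ℝ} (hΛ : 0 < Λ) (hc : 0 < c) (hF : 0 ≤ F)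
    (htp : t ≤ p) (hpT : p < T)
    (hv : ∀ τ ∈ Icc t p, HasDerivAt v (dv τ) τ) (hw : ∀ τ ∈ Icc t p, HasDerivAt w (dw τ) τ)
    (hdv : ∀ τ ∈ Icc t p, dv τ ≤ F - Λ⁻¹ * v τ * w τ)
    (hdw : ∀ τ ∈ Icc t p, Λ / 2 * v τ ^ 2 ≤ dw τ)
    (hlev : ∀ τ ∈ Icc t p, c / (T - τ) ≤ v τ) (hw0 : 0 ≤ w t) (hend : v t ≤ v p) :
    T - t ≤ (2 + 4 * (F * (T - t) ^ 2) / c ^ 3) * (T - p) := by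
  have hTt : 0 < T - t := by linarith
  have hTp : 0 < T - p := by linarith
  have hc3 : 0 < c ^ 3 := by positivity
  have h := level_cost_le_feed hΛ hc.le htp hpT hv hw hdv hdw hlev hw0 hend
  set x : ℝ := (T - t) / (T - p) with hxdef
  have hx0 : 0 < x := div_pos hTt hTp
  -- x - 1 - log x ≤ 2 F (T-t)² / c³
  have hpt : F * (p - t) * (T - t) ≤ F * (T - t) ^ 2 := by
    have h1 : F * (p - t) ≤ F * (T - t) := mul_le_mul_of_nonneg_left (by linarith) hF
    calc F * (p - t) * (T - t) ≤ F * (T - t) * (T - t) := mul_le_mul_of_nonneg_right h1 hTt.le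
      _ = F * (T - t) ^ 2 := by ring
  have h1 : x - 1 - Real.log x ≤ 2 * (F * (T - t) ^ 2) / c ^ 3 := by
    rw [le_div_iff₀ hc3]
    nlinarith
  have h2 := le_of_sub_log_le hx0 h1
  have hxe : T - t = x * (T - p) := by rw [hxdef, div_mul_cancel₀ _ hTp.ne']
  have hxle : x ≤ 2 + 4 * (F * (T - t) ^ 2) / c ^ 3 := by
    have e : 2 * (1 + 2 * (F * (T - t) ^ 2) / c ^ 3) = 2 + 4 * (F * (T - t) ^ 2) / c ^ 3 := by ring
    linarith
  calc T - t = x * (T - p) := hxe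
    _ ≤ (2 + 4 * (F * (T - t) ^ 2) / c ^ 3) * (T - p) := mul_le_mul_of_nonneg_right hxle hTp.le

/-- **Peak delay at the bottom of the rising chain (dyadic cascade).**  Let `X` solve the dyadic law
`Ẋₖ = Λᵏ⁻¹Xₖ₋₁² − ΛᵏXₖXₖ₊₁`, `Ẋₖ₊₁ = ΛᵏXₖ² − Λᵏ⁺¹Xₖ₊₁Xₖ₊₂` on `[t,p]` (`t ≤ p < T`, `Λ > 0`, `X ≥ 0` there), and
suppose on `[t,p]`: the shell below is non-increasing (`Xₖ₋₁(τ) ≤ Xₖ₋₁(t)`, i.e. past its peak) with the type-I bound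
`Λᵏ⁻¹Xₖ₋₁(t)(T−t) ≤ K` at the initial time; the look-ahead product is small, `ΛXₖ₊₁Xₖ₊₂ ≤ Xₖ²/2`; shell `k` holds the
renormalised level `ΛᵏXₖ(τ)(T−τ) ≥ c > 0`; and shell `k` has not come down, `Xₖ(t) ≤ Xₖ(p)`.  Then
`T − t ≤ (2 + 4ΛK²/c³)(T − p)`.
[cite: Tao2016AveragedNS, §1.2 (dyadic Katz–Pavlović model), §4 Lemma 4.1 (4.8); elementary (door D4′ of stmt-21808)] -/
theorem dyadic_peak_delay_bottom_shell {X : ℤ → ℝ → ℝ} {k : ℤ} {Λ K c T t p : ℝ} (hΛ : 0 < Λ) (hc : 0 < c)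
    (htp : t ≤ p) (hpT : p < T)
    (hlawk : ∀ τ ∈ Icc t p,
      HasDerivAt (X k) (Λ ^ (k - 1) * X (k - 1) τ ^ 2 - Λ ^ k * X k τ * X (k + 1) τ) τ)
    (hlawk1 : ∀ τ ∈ Icc t p,
      HasDerivAt (X (k + 1)) (Λ ^ k * X k τ ^ 2 - Λ ^ (k + 1) * X (k + 1) τ * X (k + 2) τ) τ)
    (hnn : ∀ (j : ℤ), ∀ τ ∈ Icc t p, 0 ≤ X j τ)
    (hfeed : ∀ τ ∈ Icc t p, X (k - 1) τ ≤ X (k - 1) t)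
    (htypeI : Λ ^ (k - 1) * X (k - 1) t * (T - t) ≤ K)
    (hS : ∀ τ ∈ Icc t p, Λ * X (k + 1) τ * X (k + 2) τ ≤ X k τ ^ 2 / 2)
    (hL : ∀ τ ∈ Icc t p, c ≤ Λ ^ k * X k τ * (T - τ))
    (hend : X k t ≤ X k p) :
    T - t ≤ (2 + 4 * Λ * K ^ 2 / c ^ 3) * (T - p) := by
  have hTt : 0 < T - t := by linarith
  have hTp : 0 < T - p := by linarith
  have ht : t ∈ Icc t p := left_mem_Icc.2 htp
  have hΛ0 : Λ ≠ 0 := hΛ.ne'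
  -- powers: a := Λ^(k-1) > 0, Λ^k = a Λ, Λ^(k+1) = a Λ Λ
  set a : ℝ := Λ ^ (k - 1) with ha
  have ha0 : 0 < a := zpow_pos hΛ _
  have hk : Λ ^ k = a * Λ := by
    rw [ha, ← zpow_add_one₀ hΛ0, sub_add_cancel]
  have hk1 : Λ ^ (k + 1) = a * Λ * Λ := by
    rw [zpow_add_one₀ hΛ0, hk]
  -- the two shells in u-variables
  set v : ℝ → ℝ := fun τ => Λ ^ k * X k τ with hvdef
  set w : ℝ → ℝ := fun τ => Λ ^ (k + 1) * X (k + 1) τ with hwdef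
  set dv : ℝ → ℝ := fun τ => Λ ^ k * (Λ ^ (k - 1) * X (k - 1) τ ^ 2 - Λ ^ k * X k τ * X (k + 1) τ)
    with hdvdef
  set dw : ℝ → ℝ := fun τ =>
    Λ ^ (k + 1) * (Λ ^ k * X k τ ^ 2 - Λ ^ (k + 1) * X (k + 1) τ * X (k + 2) τ) with hdwdef
  set F : ℝ := Λ * (a * X (k - 1) t) ^ 2 with hFdef
  have hF : 0 ≤ F := by positivity
  have hv : ∀ τ ∈ Icc t p, HasDerivAt v (dv τ) τ := fun τ hτ => (hlawk τ hτ).const_mul _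
  have hw : ∀ τ ∈ Icc t p, HasDerivAt w (dw τ) τ := fun τ hτ => (hlawk1 τ hτ).const_mul _
  have hdv : ∀ τ ∈ Icc t p, dv τ ≤ F - Λ⁻¹ * v τ * w τ := by
    intro τ hτ
    have h0 : 0 ≤ X (k - 1) τ := hnn _ τ hτ
    have h1 : X (k - 1) τ ≤ X (k - 1) t := hfeed τ hτ
    have hsq : X (k - 1) τ ^ 2 ≤ X (k - 1) t ^ 2 := pow_le_pow_left₀ h0 h1 2
    have e1 : dv τ = Λ * (a * X (k - 1) τ) ^ 2 - Λ⁻¹ * v τ * w τ := by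
      simp only [hdvdef, hvdef, hwdef, hk, hk1]
      field_simp
      ring
    rw [e1, hFdef]
    have : Λ * (a * X (k - 1) τ) ^ 2 ≤ Λ * (a * X (k - 1) t) ^ 2 := by
      apply mul_le_mul_of_nonneg_left _ hΛ.le
      rw [mul_pow, mul_pow]
      exact mul_le_mul_of_nonneg_left hsq (by positivity)
    linarith
  have hdw : ∀ τ ∈ Icc t p, Λ / 2 * v τ ^ 2 ≤ dw τ := by
    intro τ hτ
    have h1 : Λ * X (k + 1) τ * X (k + 2) τ ≤ X k τ ^ 2 / 2 := hS τ hτ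
    have e1 : dw τ = Λ * v τ ^ 2 - (a * Λ) ^ 2 * Λ * (Λ * X (k + 1) τ * X (k + 2) τ) := by
      simp only [hdwdef, hvdef, hk, hk1]
      ring
    have e2 : Λ / 2 * v τ ^ 2 = Λ * v τ ^ 2 - (a * Λ) ^ 2 * Λ * (X k τ ^ 2 / 2) := by
      simp only [hvdef, hk]
      ring
    rw [e1, e2]
    have hpos : 0 ≤ (a * Λ) ^ 2 * Λ := by positivity
    nlinarith
  have hlev : ∀ τ ∈ Icc t p, c / (T - τ) ≤ v τ := by
    intro τ hτ
    have hTτ : 0 < T - τ := by linarith [hτ.2]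
    rw [div_le_iff₀ hTτ]
    exact hL τ hτ
  have hw0 : 0 ≤ w t := by
    simp only [hwdef]
    exact mul_nonneg (zpow_pos hΛ _).le (hnn _ t ht)
  have hend' : v t ≤ v p := by
    simp only [hvdef]
    exact mul_le_mul_of_nonneg_left hend (zpow_pos hΛ _).le
  have h := remaining_time_le hΛ hc hF htp hpT hv hw hdv hdw hlev hw0 hend'
  -- F (T-t)² = Λ (a X_{k-1}(t) (T-t))² ≤ Λ K²
  have hu0 : 0 ≤ a * X (k - 1) t * (T - t) := by
    have := hnn (k - 1) t ht
    positivity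
  have hFK : F * (T - t) ^ 2 ≤ Λ * K ^ 2 := by
    have e : F * (T - t) ^ 2 = Λ * (a * X (k - 1) t * (T - t)) ^ 2 := by rw [hFdef]; ring
    rw [e]
    exact mul_le_mul_of_nonneg_left (pow_le_pow_left₀ hu0 htypeI 2) hΛ.le
  have hc3 : 0 < c ^ 3 := by positivity
  calc T - t ≤ (2 + 4 * (F * (T - t) ^ 2) / c ^ 3) * (T - p) := h
    _ ≤ (2 + 4 * Λ * K ^ 2 / c ^ 3) * (T - p) := by
        apply mul_le_mul_of_nonneg_right _ hTp.le
        have : 4 * (F * (T - t) ^ 2) / c ^ 3 ≤ 4 * Λ * K ^ 2 / c ^ 3 := by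
          rw [div_le_div_iff_of_pos_right hc3]
          nlinarith
        linarith

end WakeRatchetPeakDelaySelfDrain

end Summit.NavierStokesRegularity.NavierStokesRegularity.Theorems

end
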